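import Summits.PneNP.PneNP.Theorems.ChebyshevTracialDesignSpectralNonTightnessLayers
import Summits.PneNP.PneNP.Theorems.ChebyshevTracialDesignVirtualBimodePsd
import HarnessLib

/-!
# Cell pnp-psdrank, route `ChebyshevTracialDesign`: PARSEVAL FOR THE HILBERT–SCHMIDT TIGHT MODES of a matrix-valued strategy —
# `C_κ² ≤ (Σ_M ‖Y_M‖²_F)(Σ_{|U|=t} ‖X_U‖²_F)·|PM|·N₁²·A_κ/C(n,t)`, `A_κ = Π_{i<κ}(2i+1)/(n−2i)`; for contractions `‖X_U‖²_F ≤ tr X_U`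

Harmonic backbone of the crux `TracialDecayExp20` (stmt-PneNP-19878), brick 45d (prover g10). The matrix-valued companion of brick 27's
`abs_layerCorr_even_le_parseval`: the Hilbert–Schmidt tight mode `C_κ = Σ_{(a,b)} Σ_M Y_M[b,a]·Σ_{|U|=t} ((Wᵀ)^{t−2κ}p^{ab}_{2κ})(U)·1[cc(U,M)=1]`
of bricks 45b/45c (the quantity re-weighted by `R_κ = 1 + ρ_{2κ}` in the mode budget `tight_virtual_modeBudget`) obeys, for ANY dimension `r`,
* §1 `abs_weighted_layerCorr_le_energy` / `abs_weighted_layerCorr_le` — Cauchy–Schwarz in `M` (plus the tight Gram identity `sum_sq_gram_ladder`):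
  `|Σ_M y_M·col_j(M; p)| ≤ √((Σ_M y_M²)·λ_j·⟪(Wᵀ)^{t−j}p, (Wᵀ)^{t−j}p⟫)`;
* §2 `HSmode_sq_le` — Cauchy–Schwarz in the entry pair `(a,b)`: `C² ≤ (Σ_M Σ_{ab} Y_M[b,a]²)·λ_{j}·Σ_{ab} ⟪ladder_j p^{ab}, ladder_j p^{ab}⟫`;
* §3 `sum_layer_ip_le_sum_sq` — one layer's energy is at most the whole: `Σ_{ab} ⟪ladder_j p^{ab}, ladder_j p^{ab}⟫ ≤ Σ_{ab} Σ_{|U|=t} x^{ab}(U)²`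
  (`sum_sq_ladderSum`); `kernelEigen_tight_even_le` — `λ_{2κ} ≤ |PM|·N₁²/C(n,t)·A_κ` (bricks 17, 29);
* §4 `sum_sq_entries_le_trace(')` — for `0 ⪯ Y ⪯ I`, `Σ_{ab} Y[a,b]² = tr(Y²) ≤ tr Y`; hence **`HSmode_sq_le_traces`**: for entrywise-decomposed
  `X` on the `t`-cuts and contractions `X_U, Y_M`,
  `C_κ² ≤ (Σ_M tr Y_M)·(Σ_{|U|=t} tr X_U)·|PM|·N₁²·A_κ/C(n,t)`, i.e. `|C_κ|/(|PM|·N₁·C(n,t)) ≤ r·√(τ_X τ_Y A_κ)` in the trace densities: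
  the DEEP modes `κ > D/2` of the mode budget are exponentially small for psd strategies of every dimension, exactly as for rectangles —
  the crux lives in the low modes `κ ≤ D/2` (weights `ρ_{2κ} = O(κ/n)`).
[cite: Grigoriev2001, Lemma 1.4 (PDF p. 8)] [cite: BrouwerHaemers2012, Thm. 4.9.1 (PDF p. 93)] [cite: MacWilliamsSloane1977, Ch. 21 §6 Thm. 10 (PDF p. 516)]
[cite: GriblingDelaatLaurent2019, §5]
Stature: support/instrument (no defs). WHAT THIS IS NOT: no bound on the low modes; nothing on psd rank; no P-vs-NP content. Supports stmt-PneNP-19878.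
-/

set_option linter.dupNamespace false -- `Summit.PneNP.PneNP.…`: summit = sub-problem (D-0017)

noncomputable section

namespace Summit.PneNP.PneNP.Theorems.ChebyshevTracialDesignHSModeParseval

open Finset Matrix Literature.Barriers.PneNP Literature.Computability.Complexity Literature.Combinatorics.Optimization
open Literature.Combinatorics.AssociationSchemes Literature.Combinatorics.AssociationSchemes.JohnsonHarmonics
open Literature.Combinatorics.AssociationSchemes.JohnsonSpectrum
open Summit.PneNP.PneNP.Theorems.ChebyshevTracialDesignSpectralNonTightnessLayers (choose_mul_kernelEigen_zero_tight)
open Summit.PneNP.PneNP.Theorems.ChebyshevTracialDesignTightEvenProduct (kernelEigen_tight_even_le_prod)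
open Summit.PneNP.PneNP.Theorems.ChebyshevTracialDesignTracialProfilePolynomial (trace_mul_eq_sum_pairs)

variable {n : ℕ}

/-! ### §1 Weighted tight-level correlation of one layer: Cauchy–Schwarz in `M` -/

/-- **`|Σ_M y_M·h_M| ≤ √((Σ_M y_M²)·(Σ_M h_M²))`** (Cauchy–Schwarz in `M`) for the tight column sums `h_M = col_j(M; p)` of any function `p`
pushed up the ladder, and any weights `y`. -/
theorem abs_weighted_layerCorr_le_energy {t j : ℕ} (y : PMatch n → ℝ) (p : Finset (Fin n) → ℝ) :
    |∑ M : PMatch n, y M * ∑ U ∈ univ.powersetCard t,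
        (up^[t - j] p) U * (if (U.filter fun x => M.2.partner x ∉ U).card = 1 then (1 : ℝ) else 0)| ≤
      Real.sqrt ((∑ M : PMatch n, y M ^ 2) * ∑ M : PMatch n, (∑ U ∈ univ.powersetCard t,
        (up^[t - j] p) U * (if (U.filter fun x => M.2.partner x ∉ U).card = 1 then (1 : ℝ) else 0)) ^ 2) :=
  Real.abs_le_sqrt (sum_mul_sq_le_sq_mul_sq univ y _)

/-- **`|Σ_M y_M·col_j(M; p)| ≤ √((Σ_M y_M²)·λ_j·⟪(Wᵀ)^{t−j}p, (Wᵀ)^{t−j}p⟫)`** for a harmonic `p` of degree `j ≤ t`, any weights `y`, and the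
Gram class function `κ_1` of the tight incidence (`sum_sq_gram_ladder`). [cite: BrouwerHaemers2012, Thm. 4.9.1 (PDF p. 93)] -/
theorem abs_weighted_layerCorr_le {t j : ℕ} (hjt : j ≤ t) (y : PMatch n → ℝ) (p : Finset (Fin n) → ℝ) (hp : IsHarmonic j p)
    (κ₁ : ℕ → ℝ)
    (hA1 : ∀ U ∈ univ.powersetCard t, ∀ U' ∈ univ.powersetCard t,
      ∑ M : PMatch n, (if (U.filter fun x => M.2.partner x ∉ U).card = 1 then (1 : ℝ) else 0) *
        (if (U'.filter fun x => M.2.partner x ∉ U').card = 1 then (1 : ℝ) else 0) = κ₁ (U ∩ U').card) :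
    |∑ M : PMatch n, y M * ∑ U ∈ univ.powersetCard t,
        (up^[t - j] p) U * (if (U.filter fun x => M.2.partner x ∉ U).card = 1 then (1 : ℝ) else 0)| ≤
      Real.sqrt ((∑ M : PMatch n, y M ^ 2) * (kernelEigen n t j κ₁ * ip (up^[t - j] p) (up^[t - j] p))) := by
  rw [← sum_sq_gram_ladder hjt
    (fun U (M : PMatch n) => if (U.filter fun x => M.2.partner x ∉ U).card = 1 then (1 : ℝ) else 0) κ₁ hA1 hp]
  exact abs_weighted_layerCorr_le_energy y p

/-! ### §2 The Hilbert–Schmidt mode: Cauchy–Schwarz in the entry pair -/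

/-- `(Σ_i √u_i·√v_i)² ≤ (Σ u_i)(Σ v_i)` for nonnegative families. -/
theorem sq_sum_sqrt_mul_sqrt_le {ι : Type*} (s : Finset ι) (u v : ι → ℝ) (hu : ∀ i ∈ s, 0 ≤ u i) (hv : ∀ i ∈ s, 0 ≤ v i) :
    (∑ i ∈ s, Real.sqrt (u i) * Real.sqrt (v i)) ^ 2 ≤ (∑ i ∈ s, u i) * ∑ i ∈ s, v i := by
  have h := sum_mul_sq_le_sq_mul_sq s (fun i => Real.sqrt (u i)) (fun i => Real.sqrt (v i))
  have e1 : ∑ i ∈ s, Real.sqrt (u i) ^ 2 = ∑ i ∈ s, u i := sum_congr rfl fun i hi => Real.sq_sqrt (hu i hi)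
  have e2 : ∑ i ∈ s, Real.sqrt (v i) ^ 2 = ∑ i ∈ s, v i := sum_congr rfl fun i hi => Real.sq_sqrt (hv i hi)
  rwa [e1, e2] at h

/-- **`C² ≤ (Σ_M Σ_{ab} Y_M[b,a]²)·λ_j·Σ_{ab} ⟪ladder_j p^{ab}, ladder_j p^{ab}⟫`** for the Hilbert–Schmidt tight correlation
`C = Σ_{ab} Σ_M Y_M[b,a]·col_j(M; p^{ab})` of a family of degree-`j` harmonics `p^{ab}` (`j ≤ t`) with matrix weights `Y`.
[cite: BrouwerHaemers2012, Thm. 4.9.1 (PDF p. 93)] [cite: GriblingDelaatLaurent2019, §5] -/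
theorem HSmode_sq_le {t j r : ℕ} (hjt : j ≤ t) (Y : PMatch n → Matrix (Fin r) (Fin r) ℝ)
    (p : Fin r × Fin r → Finset (Fin n) → ℝ) (hp : ∀ ab, IsHarmonic j (p ab)) (κ₁ : ℕ → ℝ)
    (hA1 : ∀ U ∈ univ.powersetCard t, ∀ U' ∈ univ.powersetCard t,
      ∑ M : PMatch n, (if (U.filter fun x => M.2.partner x ∉ U).card = 1 then (1 : ℝ) else 0) *
        (if (U'.filter fun x => M.2.partner x ∉ U').card = 1 then (1 : ℝ) else 0) = κ₁ (U ∩ U').card) :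
    (∑ ab : Fin r × Fin r, ∑ M : PMatch n, Y M ab.2 ab.1 * ∑ U ∈ univ.powersetCard t,
        (up^[t - j] (p ab)) U * (if (U.filter fun x => M.2.partner x ∉ U).card = 1 then (1 : ℝ) else 0)) ^ 2 ≤
      (∑ M : PMatch n, ∑ ab : Fin r × Fin r, Y M ab.2 ab.1 ^ 2) *
        (kernelEigen n t j κ₁ * ∑ ab : Fin r × Fin r, ip (up^[t - j] (p ab)) (up^[t - j] (p ab))) := by
  -- termwise: `|c_ab| ≤ √u_ab · √v_ab` with the entry energy `u_ab` and the column energy `v_ab`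
  set u : Fin r × Fin r → ℝ := fun ab => ∑ M : PMatch n, Y M ab.2 ab.1 ^ 2 with hu
  set v : Fin r × Fin r → ℝ := fun ab => ∑ M : PMatch n, (∑ U ∈ univ.powersetCard t,
    (up^[t - j] (p ab)) U * (if (U.filter fun x => M.2.partner x ∉ U).card = 1 then (1 : ℝ) else 0)) ^ 2 with hv
  have hu0 : ∀ ab, 0 ≤ u ab := fun ab => sum_nonneg fun M _ => sq_nonneg _
  have hv0 : ∀ ab, 0 ≤ v ab := fun ab => sum_nonneg fun M _ => sq_nonneg _
  have hterm : ∀ ab : Fin r × Fin r, |∑ M : PMatch n, Y M ab.2 ab.1 * ∑ U ∈ univ.powersetCard t,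
      (up^[t - j] (p ab)) U * (if (U.filter fun x => M.2.partner x ∉ U).card = 1 then (1 : ℝ) else 0)| ≤
        Real.sqrt (u ab) * Real.sqrt (v ab) := by
    intro ab
    rw [← Real.sqrt_mul (hu0 ab)]
    exact abs_weighted_layerCorr_le_energy (fun M => Y M ab.2 ab.1) (p ab)
  have habs := (abs_sum_le_sum_abs _ _).trans (sum_le_sum fun ab (_ : ab ∈ (univ : Finset (Fin r × Fin r))) => hterm ab)
  -- the column energies are `λ_j·⟪ladder p^{ab}, ladder p^{ab}⟫`
  have hgram : ∀ ab, v ab = kernelEigen n t j κ₁ * ip (up^[t - j] (p ab)) (up^[t - j] (p ab)) := fun ab =>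
    sum_sq_gram_ladder hjt (fun U (M : PMatch n) => if (U.filter fun x => M.2.partner x ∉ U).card = 1 then (1 : ℝ) else 0)
      κ₁ hA1 (hp ab)
  calc _ = |∑ ab : Fin r × Fin r, ∑ M : PMatch n, Y M ab.2 ab.1 * ∑ U ∈ univ.powersetCard t,
        (up^[t - j] (p ab)) U * (if (U.filter fun x => M.2.partner x ∉ U).card = 1 then (1 : ℝ) else 0)| ^ 2 := (sq_abs _).symm
    _ ≤ (∑ ab : Fin r × Fin r, Real.sqrt (u ab) * Real.sqrt (v ab)) ^ 2 := pow_le_pow_left₀ (abs_nonneg _) habs 2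
    _ ≤ (∑ ab : Fin r × Fin r, u ab) * ∑ ab : Fin r × Fin r, v ab :=
        sq_sum_sqrt_mul_sqrt_le univ u v (fun ab _ => hu0 ab) (fun ab _ => hv0 ab)
    _ = _ := by rw [hu, sum_congr rfl fun ab _ => hgram ab, ← mul_sum, sum_comm]

/-! ### §3 Layer energy versus total energy; the tight eigenvalue bound -/

/-- **One layer's energy is at most the whole**: if `x^{ab} = Σ_{j'} (Wᵀ)^{t−j'} p^{ab}_{j'}` on the `t`-sets (harmonic layers), then
`Σ_{ab} ⟪(Wᵀ)^{t−j}p^{ab}_j, (Wᵀ)^{t−j}p^{ab}_j⟫ ≤ Σ_{ab} Σ_{|U|=t} x^{ab}(U)²` (`j ≤ t`). [cite: MacWilliamsSloane1977, Ch. 21 §6 Thm. 10 (PDF p. 516)] -/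
theorem sum_layer_ip_le_sum_sq {t j r : ℕ} (hjt : j ≤ t) (p : Fin r × Fin r → ℕ → Finset (Fin n) → ℝ)
    (hp : ∀ ab j', IsHarmonic j' (p ab j')) (x : Fin r × Fin r → Finset (Fin n) → ℝ)
    (hdec : ∀ ab, ∀ U ∈ univ.powersetCard t, x ab U = (∑ j' ∈ range (t + 1), up^[t - j'] (p ab j')) U) :
    ∑ ab : Fin r × Fin r, ip (up^[t - j] (p ab j)) (up^[t - j] (p ab j)) ≤
      ∑ ab : Fin r × Fin r, ∑ U ∈ univ.powersetCard t, x ab U ^ 2 := by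
  refine sum_le_sum fun ab _ => ?_
  have hpar : ∑ j' ∈ range (t + 1), ip (up^[t - j'] (p ab j')) (up^[t - j'] (p ab j')) = ∑ U ∈ univ.powersetCard t, x ab U ^ 2 := by
    rw [sum_congr rfl fun j' _ => ip_iterate_up_of_isHarmonic (hp ab j') (p ab j') (t - j'), ← sum_sq_ladderSum (p ab) (hp ab)]
    exact sum_congr rfl fun U hU => by rw [hdec ab U hU]
  rw [← hpar]
  exact single_le_sum (f := fun i => ip (up^[t - i] (p ab i)) (up^[t - i] (p ab i))) (fun i _ => ip_self_nonneg _)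
    (mem_range.2 (by omega))

/-- **`λ_{2κ} ≤ |PM|·N₁²/C(n,t)·A_κ`**, `A_κ = Π_{i<κ}(2i+1)/(n−2i)`, for the tight kernel on the `t`-cuts, `t = 2c'+1`, `2t ≤ n`, `κ ≤ c'`
(bricks 17 and 29: `C(n,t)·λ₀ = |PM|·N₁²`, `λ_{2κ} ≤ λ₀·A_κ`). [cite: BrouwerHaemers2012, Thm. 4.9.1 (PDF p. 93)] -/
theorem kernelEigen_tight_even_le {c' κ : ℕ} (hn : Even n) (ht : 2 * (2 * c' + 1) ≤ n) (hκ : κ ≤ c') (κ₁ : ℕ → ℝ)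
    (hA1 : ∀ U ∈ univ.powersetCard (2 * c' + 1), ∀ U' ∈ univ.powersetCard (2 * c' + 1),
      ∑ M : PMatch n, (if (U.filter fun x => M.2.partner x ∉ U).card = 1 then (1 : ℝ) else 0) *
        (if (U'.filter fun x => M.2.partner x ∉ U').card = 1 then (1 : ℝ) else 0) = κ₁ (U ∩ U').card) :
    kernelEigen n (2 * c' + 1) (2 * κ) κ₁ ≤
      (Fintype.card (PMatch n) : ℝ) * ((((n / 2).choose (1 + c') * (1 + c').choose c' * 2 ^ 1 : ℕ) : ℝ)) ^ 2 /
        (n.choose (2 * c' + 1) : ℝ) * ∏ i ∈ range κ, ((2 * i + 1 : ℝ) / ((n : ℝ) - 2 * i)) := by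
  have h1 := kernelEigen_tight_even_le_prod hn ht hκ κ₁ hA1
  have h0 := choose_mul_kernelEigen_zero_tight ht κ₁ hA1
  have hch : (0 : ℝ) < (n.choose (2 * c' + 1) : ℝ) := by exact_mod_cast Nat.choose_pos (by omega)
  have heq : kernelEigen n (2 * c' + 1) 0 κ₁ =
      (Fintype.card (PMatch n) : ℝ) * ((((n / 2).choose (1 + c') * (1 + c').choose c' * 2 ^ 1 : ℕ) : ℝ)) ^ 2 /
        (n.choose (2 * c' + 1) : ℝ) := by
    rw [eq_div_iff hch.ne', mul_comm, h0]
  rw [← heq]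
  exact h1

/-! ### §4 Contractions: `Σ_{ab} Y[b,a]² ≤ tr Y`, and the mode bound in trace densities -/

/-- For `0 ⪯ Y ⪯ I`: `Σ_{(a,b)} Y[a,b]² = tr(Y·Y) ≤ tr Y`. -/
theorem sum_sq_entries_le_trace {r : ℕ} {Y : Matrix (Fin r) (Fin r) ℝ} (hY : Y.PosSemidef) (hY1 : (1 - Y).PosSemidef) :
    ∑ ab : Fin r × Fin r, Y ab.1 ab.2 ^ 2 ≤ Y.trace := by
  have hsym : ∀ a b : Fin r, Y b a = Y a b := fun a b => by
    simpa [conjTranspose_apply] using congrFun (congrFun hY.1 a) b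
  have htr : (Y * Y).trace = ∑ ab : Fin r × Fin r, Y ab.1 ab.2 ^ 2 := by
    rw [trace_mul_eq_sum_pairs]
    exact sum_congr rfl fun ab _ => by rw [hsym ab.1 ab.2, sq]
  rw [← htr]
  exact Summit.PneNP.PneNP.Theorems.ChebyshevTracialDesignAPrioriBounds.trace_mul_le_trace_left hY hY1

/-- For `0 ⪯ Y ⪯ I`: `Σ_{(a,b)} Y[b,a]² ≤ tr Y` (the transposed indexing of `sum_sq_entries_le_trace`). -/
theorem sum_sq_entries_le_trace' {r : ℕ} {Y : Matrix (Fin r) (Fin r) ℝ} (hY : Y.PosSemidef) (hY1 : (1 - Y).PosSemidef) :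
    ∑ ab : Fin r × Fin r, Y ab.2 ab.1 ^ 2 ≤ Y.trace := by
  rw [← Fintype.sum_equiv (Equiv.prodComm (Fin r) (Fin r)) (fun ab : Fin r × Fin r => Y ab.1 ab.2 ^ 2) _ fun ab => rfl]
  exact sum_sq_entries_le_trace hY hY1

/-- **THE MODE BOUND IN TRACE DENSITIES.** For `n` even, `t = 2c'+1`, `2t ≤ n`, `κ ≤ c'`, contractions `0 ⪯ X_U, Y_M ⪯ I` (any dimension `r`)
and entrywise harmonic layers `p^{ab}` of `X` on the `t`-cuts:
`C_κ² ≤ (Σ_M tr Y_M)·(Σ_{|U|=t} tr X_U)·(|PM|·N₁²·A_κ/C(n,t))` — i.e. `|C_κ| ≤ (|PM|·N₁·C(n,t))·r·√(τ_X τ_Y A_κ)` with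
`τ_X = Σ_{|U|=t} tr X_U/(r·C(n,t))`, `τ_Y = Σ_M tr Y_M/(r·|PM|)`.
[cite: Grigoriev2001, Lemma 1.4 (PDF p. 8)] [cite: BrouwerHaemers2012, Thm. 4.9.1 (PDF p. 93)] [cite: GriblingDelaatLaurent2019, §5] -/
theorem HSmode_sq_le_traces {c' κ r : ℕ} (hn : Even n) (ht : 2 * (2 * c' + 1) ≤ n) (hκ : κ ≤ c')
    (X : OddSet n → Matrix (Fin r) (Fin r) ℝ) (Y : PMatch n → Matrix (Fin r) (Fin r) ℝ)
    (hX : ∀ U, (X U).PosSemidef ∧ (1 - X U).PosSemidef) (hY : ∀ M, (Y M).PosSemidef ∧ (1 - Y M).PosSemidef)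
    (p : Fin r × Fin r → ℕ → Finset (Fin n) → ℝ) (hp : ∀ ab j, IsHarmonic j (p ab j))
    (hpdec : ∀ ab (U : OddSet n), U.1.card = 2 * c' + 1 →
      X U ab.1 ab.2 = (∑ j ∈ range (2 * c' + 1 + 1), up^[2 * c' + 1 - j] (p ab j)) U.1)
    (κ₁ : ℕ → ℝ)
    (hA1 : ∀ U ∈ univ.powersetCard (2 * c' + 1), ∀ U' ∈ univ.powersetCard (2 * c' + 1),
      ∑ M : PMatch n, (if (U.filter fun x => M.2.partner x ∉ U).card = 1 then (1 : ℝ) else 0) *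
        (if (U'.filter fun x => M.2.partner x ∉ U').card = 1 then (1 : ℝ) else 0) = κ₁ (U ∩ U').card) :
    (∑ ab : Fin r × Fin r, ∑ M : PMatch n, Y M ab.2 ab.1 * ∑ U ∈ univ.powersetCard (2 * c' + 1),
        (up^[2 * c' + 1 - 2 * κ] (p ab (2 * κ))) U * (if (U.filter fun x => M.2.partner x ∉ U).card = 1 then (1 : ℝ) else 0)) ^ 2 ≤
      (∑ M : PMatch n, (Y M).trace) * (∑ U ∈ univ.filter (fun U : OddSet n => U.1.card = 2 * c' + 1), (X U).trace) *
        ((Fintype.card (PMatch n) : ℝ) * ((((n / 2).choose (1 + c') * (1 + c').choose c' * 2 ^ 1 : ℕ) : ℝ)) ^ 2 /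
          (n.choose (2 * c' + 1) : ℝ) * ∏ i ∈ range κ, ((2 * i + 1 : ℝ) / ((n : ℝ) - 2 * i))) := by
  classical
  have h2 := HSmode_sq_le (t := 2 * c' + 1) (j := 2 * κ) (by omega) Y (fun ab => p ab (2 * κ)) (fun ab => hp ab (2 * κ)) κ₁ hA1
  -- the `Y`-energy
  have hYtr : ∑ M : PMatch n, ∑ ab : Fin r × Fin r, Y M ab.2 ab.1 ^ 2 ≤ ∑ M : PMatch n, (Y M).trace :=
    sum_le_sum fun M _ => sum_sq_entries_le_trace' (hY M).1 (hY M).2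
  -- the `X`-energy: entry functions on the `t`-sets
  set x : Fin r × Fin r → Finset (Fin n) → ℝ := fun ab U => if h : Odd U.card then X ⟨U, h⟩ ab.1 ab.2 else 0 with hx
  have hdec : ∀ ab, ∀ U ∈ univ.powersetCard (2 * c' + 1), x ab U = (∑ j' ∈ range (2 * c' + 1 + 1), up^[2 * c' + 1 - j'] (p ab j')) U := by
    intro ab U hU
    have hcard : U.card = 2 * c' + 1 := (mem_powersetCard.1 hU).2
    have hodd : Odd U.card := ⟨c', hcard⟩
    simp only [hx, dif_pos hodd]
    exact hpdec ab ⟨U, hodd⟩ hcard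
  have hlayer := sum_layer_ip_le_sum_sq (t := 2 * c' + 1) (j := 2 * κ) (by omega) p hp x hdec
  have hXtr : ∑ ab : Fin r × Fin r, ∑ U ∈ univ.powersetCard (2 * c' + 1), x ab U ^ 2 ≤
      ∑ U ∈ univ.filter (fun U : OddSet n => U.1.card = 2 * c' + 1), (X U).trace := by
    rw [sum_comm]
    -- reindex the `t`-sets as odd cuts
    have h := Summit.PneNP.PneNP.Theorems.ChebyshevTracialDesignTightColumnSums.sum_oddSet_eq_sum_powersetCard
      (n := n) (t := 2 * c' + 1) ⟨c', rfl⟩ (fun _ => True) (fun U => ∑ ab : Fin r × Fin r, x ab U ^ 2)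
    rw [filter_true] at h
    rw [← h]
    have hf : univ.filter (fun U : OddSet n => U.1.card = 2 * c' + 1 ∧ True) =
        univ.filter (fun U : OddSet n => U.1.card = 2 * c' + 1) := filter_congr fun U _ => by simp
    rw [hf]
    refine sum_le_sum fun U _ => ?_
    have hxU : ∀ ab : Fin r × Fin r, x ab U.1 = X U ab.1 ab.2 := fun ab => by simp only [hx, dif_pos U.2]
    rw [sum_congr rfl fun ab _ => by rw [hxU ab]]
    exact sum_sq_entries_le_trace (hX U).1 (hX U).2
  have hlam := kernelEigen_tight_even_le hn ht hκ κ₁ hA1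
  have hlam0 : 0 ≤ kernelEigen n (2 * c' + 1) (2 * κ) κ₁ :=
    Summit.PneNP.PneNP.Theorems.ChebyshevTracialDesignTightEigenDecay.kernelEigen_tight_even_nonneg hn ht hκ κ₁ hA1
  have hip0 : 0 ≤ ∑ ab : Fin r × Fin r, ip (up^[2 * c' + 1 - 2 * κ] (p ab (2 * κ))) (up^[2 * c' + 1 - 2 * κ] (p ab (2 * κ))) :=
    sum_nonneg fun ab _ => ip_self_nonneg _
  have hYe0 : 0 ≤ ∑ M : PMatch n, ∑ ab : Fin r × Fin r, Y M ab.2 ab.1 ^ 2 := sum_nonneg fun M _ => sum_nonneg fun ab _ => sq_nonneg _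
  have hXtr0 : 0 ≤ ∑ U ∈ univ.filter (fun U : OddSet n => U.1.card = 2 * c' + 1), (X U).trace :=
    le_trans (sum_nonneg fun ab _ => sum_nonneg fun U _ => sq_nonneg _) hXtr
  calc _ ≤ _ := h2
    _ ≤ (∑ M : PMatch n, (Y M).trace) * (kernelEigen n (2 * c' + 1) (2 * κ) κ₁ *
          ∑ U ∈ univ.filter (fun U : OddSet n => U.1.card = 2 * c' + 1), (X U).trace) := by
        refine mul_le_mul hYtr (mul_le_mul_of_nonneg_left (hlayer.trans hXtr) hlam0) (mul_nonneg hlam0 hip0) ?_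
        exact hYe0.trans hYtr
    _ ≤ (∑ M : PMatch n, (Y M).trace) * (((Fintype.card (PMatch n) : ℝ) *
          ((((n / 2).choose (1 + c') * (1 + c').choose c' * 2 ^ 1 : ℕ) : ℝ)) ^ 2 / (n.choose (2 * c' + 1) : ℝ) *
            ∏ i ∈ range κ, ((2 * i + 1 : ℝ) / ((n : ℝ) - 2 * i))) *
          ∑ U ∈ univ.filter (fun U : OddSet n => U.1.card = 2 * c' + 1), (X U).trace) :=
        mul_le_mul_of_nonneg_left (mul_le_mul_of_nonneg_right hlam hXtr0) (hYe0.trans hYtr)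
    _ = _ := by ring

end Summit.PneNP.PneNP.Theorems.ChebyshevTracialDesignHSModeParseval
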